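import Mathlib.Data.Set.Card
import Mathlib.Algebra.BigOperators.Finprod
import Mathlib.Order.LiminfLimsup
import Mathlib.Topology.Order.Real
import Literature.MathematicalPhysics.StatisticalMechanics.FccTexturedSet
import Literature.MathematicalPhysics.StatisticalMechanics.BarlowCoordination
import Literature.Geometry.DiscreteGeometry.KissingNumberThreeProofs
import HarnessLib

/-!
# The interface (grain-boundary) energy density of two rigid fcc half-crystals of sticky spheres

Topic `Literature/MathematicalPhysics/StatisticalMechanics` (namespace = path).  Definition request
`defn-StickyInterfaceEnergy` of the venture `Summits/Ventures/Crystal3D` (route `StickyWulffConstant`,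
crux `LiminfAssembly` = `stmt-Ventures-19146`, children `TextureLiminfTau` / `BoundaryCostFloor` of
the cell's SPLIT-SPEC; companion of `FccTexturedSet.lean`).

## What is defined

Sticky unit spheres: centres `X ⊆ ℝ³` with pairwise distance `≥ 1` (`IsUnitPacking`), two balls in
CONTACT when their centres are at distance exactly `1`; the energy of a finite cluster is minus the
number of contacts, i.e. up to the bulk term `6·#X` it is the *deficiency*
`Σ_{x ∈ X} (12 − deg x)/2 = 6·#X − C(X)` (Cicalese–Kreutz–Leonardi, p. 6, `G_{L,ε}`; the tree's
`contactDeficiency`, with which the local form below agrees: `sum_localDeficiency`).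

For two ORIENTATIONS `A, B ∈ O(3)` (linear isometries of `ℝ³`; the reference crystal is the fcc
packing `Λ₀ = fccHost = fccStacking 1 √(2/3)` of nearest-neighbour distance `1`, `0 ∈ Λ₀`) and an
interface normal `n` (a unit vector), the **interface energy density** `τ(A, B, n)`
(`stickyInterfaceEnergy A B n`) is the cell-problem limit

  `τ(A, B, n) = inf_{R ≥ 1} liminf_{ρ → ∞} (π ρ²)⁻¹ · inf { D_{n,ρ,R}(X) : X admissible }`,

where a configuration `X` is ADMISSIBLE for `(A, B, n, R)` (`IsBicrystalAdmissible`) when it is a unit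
packing which coincides with the rigid half-crystal `A·Λ₀` on the half-space `{⟪y, n⟫ ≤ −R}` and
with a translate `B·Λ₀ + t` (the translation `t ∈ ℝ³` is FREE) on `{⟪y, n⟫ ≥ R}` — inside the slab
`|⟪y, n⟫| < R` it is arbitrary — and `D_{n,ρ,R}(X)` (`interfaceCellDeficiency`) is the sum of the local
deficiencies `(12 − deg_X y)/2` over the balls `y ∈ X` of the cell
`{‖y − ⟪y,n⟫ n‖ ≤ ρ, |⟪y,n⟫| ≤ R + 1}` (lateral radius `ρ` about the axis `ℝ n`; the collar of
width `1` beyond the slab is there so that the cell energy of a fixed admissible `X` does not depend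
on `R' ≥ R` — balls of a perfect half-crystal farther than `1` from the slab have all twelve
neighbours — which makes `R ↦ τ_R` non-increasing; this bookkeeping is not proved here).
This is the shape of the asymptotic cell formula for the interfacial energy density between two
ground states `v^l`, `v^{l'}` across the plane `ν^⊥`,
`φ(l, l', ν) = lim_δ liminf_T T^{1−d} inf {E₁(u, Q_T^ν) : u = u^{l,l',ν} outside Q_{(1−δ)T}^ν}`,
of Alicandro–Braides–Cicalese–Solci, *Discrete Variational Problems with Interfaces*, Thm. 7.10,
(7.7)–(7.8) [corpus: book:alicandro2023-discrete-variational-problems-with-interfaces chunk p0206;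
the fixed-range version (3.11)–(3.12), Def. 3.11 "surface tension", chunk p0074], transcribed to the
sticky-sphere energy with RIGID far fields: the boundary datum is the pair of half-crystals, the
free boundary layer `δT` becomes the free slab of half-width `R` (then `R → ∞`), and the cube face
`T^{d−1}` becomes the disc area `π ρ²`.  The printed sources treat lattice spin systems; the
rigid-sphere bicrystal cell problem itself is the cell's rendering (planner text of the item; no
printed statement is claimed for it — this file contains DEFINITIONS and PROVED sanity properties
only, no named facts).

## Proved

* `contactDegree_le_twelve` — in a unit packing every ball touches at most twelve others (the
  kissing number of `ℝ³`, from the tree's PROVED `musin2006_kissing_three_holds`), hence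
  `localDeficiency_nonneg`, `interfaceCellDeficiency_nonneg`, `stickyInterfaceCellInf_nonneg`,
  `stickyInterfaceEnergyAt_nonneg`, **`stickyInterfaceEnergy_nonneg : 0 ≤ τ(A, B, n)`**;
* `isUnitPacking_fccHost`, `contactDegree_fccHost = 12`, invariance of degrees under isometries,
  `isBicrystalAdmissible_rigidCrystal` (the perfect crystal `A·Λ₀` is admissible for `B = A`) and
  **`stickyInterfaceEnergy_self : τ(A, A, n) = 0`** (no boundary, no cost);
* `sum_localDeficiency : Σ_{x ∈ X} localDeficiency X x = contactDeficiency X` for finite `X`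
  (consistency with `StickyWulffConstants.lean`);
* `isBicrystalAdmissible_gap` — for `‖n‖ = 1` and `R ≥ 1/2` the "gap" configuration (the two
  half-crystals and nothing in the slab) is admissible, so the cell problem is never empty for the
  `R ≥ 1` used in `τ`.

NOT here (uses, not definitions): `τ > 0` off the coherent `Σ3` twins and `τ(twin (111)) = 0`
(Winterbottom neutrality) — the latter is provable from `BarlowCoordination.lean` (every Hägg
stacking is twelve-coordinated) once the reversed stacking is identified with a reflected fcc
half-crystal; left to a follow-up.  No instances, no notation, no `sorry`, no named facts.

## References

* R. Alicandro, A. Braides, M. Cicalese, M. Solci, *Discrete Variational Problems with Interfaces*,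
  CUP 2023, Thm. 7.10, (7.7)–(7.8); (3.11)–(3.12), Def. 3.11.
* M. Cicalese, L. Kreutz, G. P. Leonardi, *Emergence of Wulff-crystals from atomistic systems on the
  FCC and HCP lattices*, CMP 2023, §1–§2 (the energy, p. 6).
* O. R. Musin, *The kissing number in three dimensions* (tree: `musin2006_kissing_three_holds`).
* W. L. Winterbottom, Acta Metall. 15 (1967); D. Wolf, K. L. Merkle in *Materials Interfaces* (1992);
  A. P. Sutton, R. W. Balluffi, *Interfaces in Crystalline Materials* (1995) — the physics of
  grain-boundary energies as functions of misorientation AND inclination (context only).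
-/

noncomputable section

open scoped RealInnerProductSpace
open Literature.Geometry.DiscreteGeometry (musin2006_kissing_three musin2006_kissing_three_holds)

namespace Literature.MathematicalPhysics.StatisticalMechanics

/-! ## §1 Unit packings, contact degree, local deficiency -/

section Packing

/-- A **unit packing** (sticky hard spheres of diameter `1`): a set of centres with pairwise
distance `≥ 1` [cite: CicaleseKreutzLeonardi2023, §1 (2) (hard core, contact at distance 1)]. -/
def IsUnitPacking (X : Set (EuclideanSpace ℝ (Fin 3))) : Prop :=
  X.Pairwise fun x y => 1 ≤ dist x y

/-- The balls of `X` in CONTACT with the ball centred at `x` (centres at distance exactly `1`)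
[cite: CicaleseKreutzLeonardi2023, §1 (2) (`N(x) ∩ X`)]. -/
def contactSet (X : Set (EuclideanSpace ℝ (Fin 3))) (x : EuclideanSpace ℝ (Fin 3)) :
    Set (EuclideanSpace ℝ (Fin 3)) :=
  {y | y ∈ X ∧ dist x y = 1}

/-- The **contact degree** `deg_X x = #{y ∈ X : |x − y| = 1}` (a natural number; `Set.ncard`, so
`0` on an infinite contact set — which does not occur in a packing, `contactSet_finite`)
[cite: CicaleseKreutzLeonardi2023, §1 (2)]. -/
def contactDegree (X : Set (EuclideanSpace ℝ (Fin 3))) (x : EuclideanSpace ℝ (Fin 3)) : ℕ :=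
  (contactSet X x).ncard

/-- The **local deficiency** `(12 − deg_X x)/2` of the ball at `x`: one half of its missing bonds
relative to the bulk coordination `12`; summing over a finite cluster gives `6·#X − C(X)`
(`sum_localDeficiency`) [cite: CicaleseKreutzLeonardi2023, p. 6 (the summand `12 − #(N_ε(x) ∩ X)` of `G_{L,ε}`)]. -/
def localDeficiency (X : Set (EuclideanSpace ℝ (Fin 3))) (x : EuclideanSpace ℝ (Fin 3)) : ℝ :=
  (12 - (contactDegree X x : ℝ)) / 2

variable {X : Set (EuclideanSpace ℝ (Fin 3))}

/-- [cite: CicaleseKreutzLeonardi2023, §1 (2)] -/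
theorem mem_contactSet_iff {x y : EuclideanSpace ℝ (Fin 3)} :
    y ∈ contactSet X x ↔ y ∈ X ∧ dist x y = 1 := Iff.rfl

/-- [cite: CicaleseKreutzLeonardi2023, §1 (2)] -/
theorem contactSet_subset (x : EuclideanSpace ℝ (Fin 3)) : contactSet X x ⊆ X := fun _ hy => hy.1

/-- A subset of a unit packing is a unit packing [cite: CicaleseKreutzLeonardi2023, §1 (2)]. -/
theorem IsUnitPacking.mono {Y : Set (EuclideanSpace ℝ (Fin 3))} (hX : IsUnitPacking X) (hY : Y ⊆ X) :
    IsUnitPacking Y :=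
  Set.Pairwise.mono hY hX

/-- **Kissing bound for finite contact configurations**: a finite set of balls of a unit packing
all touching the ball at `x` has at most twelve elements — translate by `−x` and apply the kissing
number theorem `k(3) = 12` (tree: `musin2006_kissing_three_holds`)
[cite: Musin2005, p. 4 Theorem (k(3) = 12)]. -/
theorem card_le_twelve_of_subset_contactSet (hX : IsUnitPacking X) {x : EuclideanSpace ℝ (Fin 3)}
    {T : Finset (EuclideanSpace ℝ (Fin 3))} (hT : ↑T ⊆ contactSet X x) : T.card ≤ 12 := by
  classical
  have hk : musin2006_kissing_three := musin2006_kissing_three_holds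
  have hinj : Function.Injective fun y : EuclideanSpace ℝ (Fin 3) => y - x :=
    fun a b hab => sub_left_injective hab
  rw [← Finset.card_image_of_injective T hinj]
  refine hk _ (fun v hv => ?_) (fun v hv w hw hvw => ?_)
  · obtain ⟨y, hy, rfl⟩ := Finset.mem_image.mp hv
    have h := (hT hy).2
    rw [← dist_eq_norm, dist_comm]
    exact h
  · obtain ⟨y, hy, rfl⟩ := Finset.mem_image.mp hv
    obtain ⟨z, hz, rfl⟩ := Finset.mem_image.mp hw
    have hyz : y ≠ z := fun h => hvw (by rw [h])
    rw [dist_sub_right]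
    exact hX (hT hy).1 (hT hz).1 hyz

/-- In a unit packing every contact set is finite [cite: Musin2005, p. 4 Theorem (k(3) = 12)]. -/
theorem contactSet_finite (hX : IsUnitPacking X) (x : EuclideanSpace ℝ (Fin 3)) :
    (contactSet X x).Finite := by
  by_contra hinf
  obtain ⟨T, hT, hcard⟩ := Set.Infinite.exists_subset_card_eq hinf 13
  have := card_le_twelve_of_subset_contactSet hX hT
  omega

/-- **The kissing number of `ℝ³` is twelve**: in a unit packing every ball touches at most twelve
others (tree: `musin2006_kissing_three_holds`) [cite: Musin2005, p. 4 Theorem (k(3) = 12)]. -/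
theorem contactDegree_le_twelve (hX : IsUnitPacking X) (x : EuclideanSpace ℝ (Fin 3)) :
    contactDegree X x ≤ 12 := by
  unfold contactDegree
  rw [Set.ncard_eq_toFinset_card _ (contactSet_finite hX x)]
  exact card_le_twelve_of_subset_contactSet hX (x := x) (by simp)

/-- In a unit packing the local deficiency is non-negative
[cite: CicaleseKreutzLeonardi2023, p. 6]. -/
theorem localDeficiency_nonneg (hX : IsUnitPacking X) (x : EuclideanSpace ℝ (Fin 3)) :
    0 ≤ localDeficiency X x := by
  unfold localDeficiency
  have h : (contactDegree X x : ℝ) ≤ 12 := by exact_mod_cast contactDegree_le_twelve hX x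
  linarith

/-- A ball with (at least) twelve contacts has local deficiency `0`
[cite: CicaleseKreutzLeonardi2023, p. 6]. -/
theorem localDeficiency_eq_zero_of_contactDegree_eq {x : EuclideanSpace ℝ (Fin 3)}
    (h : contactDegree X x = 12) : localDeficiency X x = 0 := by
  simp [localDeficiency, h]

/-! ### Consistency with the finite-cluster deficiency `6·#X − C(X)` -/

/-- For a finite cluster the contact degree at `x ∈ X` is the number of `y ∈ X` at distance `1`
[cite: CicaleseKreutzLeonardi2023, §1 (2)]. -/
theorem contactDegree_coe_finset (X : Finset (EuclideanSpace ℝ (Fin 3))) (x : EuclideanSpace ℝ (Fin 3)) :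
    contactDegree (↑X) x = (X.filter fun y => dist x y = 1).card := by
  unfold contactDegree
  have : contactSet (↑X : Set (EuclideanSpace ℝ (Fin 3))) x = ↑(X.filter fun y => dist x y = 1) := by
    ext y; simp [mem_contactSet_iff]
  rw [this, Set.ncard_coe_finset]

/-- **Local form of the deficiency**: for a finite cluster, `Σ_{x ∈ X} (12 − deg x)/2 = 6·#X − C(X)`
is the tree's `contactDeficiency X` [cite: CicaleseKreutzLeonardi2023, p. 6 (definition of `G_{L,ε}`)]. -/
theorem sum_localDeficiency (X : Finset (EuclideanSpace ℝ (Fin 3))) :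
    ∑ x ∈ X, localDeficiency (↑X) x = contactDeficiency X := by
  classical
  unfold localDeficiency contactDeficiency orderedContacts
  have hdeg : ∀ x ∈ X, (contactDegree (↑X : Set (EuclideanSpace ℝ (Fin 3))) x : ℝ) =
      ((X.filter fun y => dist x y = 1).card : ℝ) := fun x _ => by
    rw [contactDegree_coe_finset]
  have hprod : ((X ×ˢ X).filter fun p : EuclideanSpace ℝ (Fin 3) × EuclideanSpace ℝ (Fin 3) =>
      dist p.1 p.2 = 1).card = ∑ x ∈ X, (X.filter fun y => dist x y = 1).card := by
    rw [Finset.card_filter, Finset.sum_product]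
    refine Finset.sum_congr rfl fun x _ => ?_
    rw [Finset.card_filter]
  rw [hprod, Nat.cast_sum]
  calc ∑ x ∈ X, (12 - (contactDegree (↑X : Set (EuclideanSpace ℝ (Fin 3))) x : ℝ)) / 2
      = ∑ x ∈ X, (6 - ((X.filter fun y => dist x y = 1).card : ℝ) / 2) :=
        Finset.sum_congr rfl fun x hx => by rw [hdeg x hx]; ring
    _ = 6 * (X.card : ℝ) - (∑ x ∈ X, ((X.filter fun y => dist x y = 1).card : ℝ)) / 2 := by
        rw [Finset.sum_sub_distrib, Finset.sum_const, nsmul_eq_mul, Finset.sum_div]; ring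

/-! ### Isometry invariance -/

/-- Isometries preserve unit packings [cite: CicaleseKreutzLeonardi2023, §1 (2)]. -/
theorem IsUnitPacking.image (hX : IsUnitPacking X)
    (g : EuclideanSpace ℝ (Fin 3) ≃ᵢ EuclideanSpace ℝ (Fin 3)) : IsUnitPacking (g '' X) := by
  rintro _ ⟨x, hx, rfl⟩ _ ⟨y, hy, rfl⟩ hne
  rw [g.dist_eq]
  exact hX hx hy fun h => hne (by rw [h])

/-- Isometries map contact sets to contact sets [cite: CicaleseKreutzLeonardi2023, §1 (2)]. -/
theorem contactSet_image (g : EuclideanSpace ℝ (Fin 3) ≃ᵢ EuclideanSpace ℝ (Fin 3))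
    (x : EuclideanSpace ℝ (Fin 3)) : contactSet (g '' X) (g x) = g '' contactSet X x := by
  ext y
  simp only [mem_contactSet_iff, Set.mem_image]
  constructor
  · rintro ⟨⟨z, hz, rfl⟩, hd⟩
    exact ⟨z, ⟨hz, by rwa [g.dist_eq] at hd⟩, rfl⟩
  · rintro ⟨z, ⟨hz, hd⟩, rfl⟩
    exact ⟨⟨z, hz, rfl⟩, by rwa [g.dist_eq]⟩

/-- Isometries preserve contact degrees [cite: CicaleseKreutzLeonardi2023, §1 (2)]. -/
theorem contactDegree_image (g : EuclideanSpace ℝ (Fin 3) ≃ᵢ EuclideanSpace ℝ (Fin 3))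
    (x : EuclideanSpace ℝ (Fin 3)) : contactDegree (g '' X) (g x) = contactDegree X x := by
  unfold contactDegree
  rw [contactSet_image, Set.ncard_image_of_injective _ g.injective]

/-- Isometries preserve local deficiencies [cite: CicaleseKreutzLeonardi2023, p. 6]. -/
theorem localDeficiency_image (g : EuclideanSpace ℝ (Fin 3) ≃ᵢ EuclideanSpace ℝ (Fin 3))
    (x : EuclideanSpace ℝ (Fin 3)) : localDeficiency (g '' X) (g x) = localDeficiency X x := by
  unfold localDeficiency
  rw [contactDegree_image]

end Packing

/-! ## §2 The reference crystal `Λ₀ = fccHost` and its rigid copies -/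

section Crystal

/-- The fcc packing of nearest-neighbour distance `1` is a unit packing (ideal Barlow stacking,
`BarlowCoordination.le_dist_of_mem_barlowStacking_ideal`) [cite: HalesDSP2012, §1.3]. -/
theorem isUnitPacking_fccHost : IsUnitPacking fccHost := by
  intro x hx y hy hxy
  have hh : (Real.sqrt (2 / 3)) ^ 2 = 2 / 3 * (1 : ℝ) ^ 2 := by
    rw [Real.sq_sqrt (by norm_num)]; ring
  exact le_dist_of_mem_barlowStacking_ideal isHaggSeq_const one_pos hh hx hy hxy

/-- Every ball of the fcc packing touches exactly twelve others
(`BarlowCoordination.ncard_touching_eq_twelve`) [cite: HalesDSP2012, §1.3]. -/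
theorem contactDegree_fccHost {u : EuclideanSpace ℝ (Fin 3)} (hu : u ∈ fccHost) :
    contactDegree fccHost u = 12 := by
  have hh : (Real.sqrt (2 / 3)) ^ 2 = 2 / 3 * (1 : ℝ) ^ 2 := by
    rw [Real.sq_sqrt (by norm_num)]; ring
  exact ncard_touching_eq_twelve isHaggSeq_const one_pos hh hu

/-- [cite: CicaleseKreutzLeonardi2023, p. 6] -/
theorem localDeficiency_fccHost {u : EuclideanSpace ℝ (Fin 3)} (hu : u ∈ fccHost) :
    localDeficiency fccHost u = 0 :=
  localDeficiency_eq_zero_of_contactDegree_eq (contactDegree_fccHost hu)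

/-- The affine isometry `v ↦ A v + t` of an orientation `A ∈ O(3)` and a translation `t`
[cite: KreutzZiereis2026, (2.5)–(2.6) (rigid motions acting on the reference lattice)]. -/
def rigidMotion (A : EuclideanSpace ℝ (Fin 3) ≃ₗᵢ[ℝ] EuclideanSpace ℝ (Fin 3))
    (t : EuclideanSpace ℝ (Fin 3)) : EuclideanSpace ℝ (Fin 3) ≃ᵢ EuclideanSpace ℝ (Fin 3) :=
  A.toIsometryEquiv.trans (IsometryEquiv.addRight t)

/-- [cite: KreutzZiereis2026, (2.5)–(2.6)] -/
@[simp]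
theorem rigidMotion_apply (A : EuclideanSpace ℝ (Fin 3) ≃ₗᵢ[ℝ] EuclideanSpace ℝ (Fin 3))
    (t v : EuclideanSpace ℝ (Fin 3)) : rigidMotion A t v = A v + t := rfl

/-- The **rigid crystal** `A·Λ₀ + t`: the fcc packing in orientation `A` translated by `t`
[cite: KreutzZiereis2026, (2.5)–(2.6)]. -/
def rigidCrystal (A : EuclideanSpace ℝ (Fin 3) ≃ₗᵢ[ℝ] EuclideanSpace ℝ (Fin 3))
    (t : EuclideanSpace ℝ (Fin 3)) : Set (EuclideanSpace ℝ (Fin 3)) :=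
  rigidMotion A t '' fccHost

/-- [cite: KreutzZiereis2026, (2.5)–(2.6)] -/
theorem rigidCrystal_eq_image (A : EuclideanSpace ℝ (Fin 3) ≃ₗᵢ[ℝ] EuclideanSpace ℝ (Fin 3))
    (t : EuclideanSpace ℝ (Fin 3)) : rigidCrystal A t = (fun v => A v + t) '' fccHost := rfl

/-- A rigid crystal is a unit packing [cite: HalesDSP2012, §1.3]. -/
theorem isUnitPacking_rigidCrystal (A : EuclideanSpace ℝ (Fin 3) ≃ₗᵢ[ℝ] EuclideanSpace ℝ (Fin 3))
    (t : EuclideanSpace ℝ (Fin 3)) : IsUnitPacking (rigidCrystal A t) :=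
  isUnitPacking_fccHost.image _

/-- Every ball of a rigid crystal touches exactly twelve others [cite: HalesDSP2012, §1.3]. -/
theorem contactDegree_rigidCrystal (A : EuclideanSpace ℝ (Fin 3) ≃ₗᵢ[ℝ] EuclideanSpace ℝ (Fin 3))
    (t : EuclideanSpace ℝ (Fin 3)) {y : EuclideanSpace ℝ (Fin 3)} (hy : y ∈ rigidCrystal A t) :
    contactDegree (rigidCrystal A t) y = 12 := by
  obtain ⟨u, hu, rfl⟩ := hy
  unfold rigidCrystal
  rw [contactDegree_image, contactDegree_fccHost hu]

/-- [cite: CicaleseKreutzLeonardi2023, p. 6] -/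
theorem localDeficiency_rigidCrystal (A : EuclideanSpace ℝ (Fin 3) ≃ₗᵢ[ℝ] EuclideanSpace ℝ (Fin 3))
    (t : EuclideanSpace ℝ (Fin 3)) {y : EuclideanSpace ℝ (Fin 3)} (hy : y ∈ rigidCrystal A t) :
    localDeficiency (rigidCrystal A t) y = 0 :=
  localDeficiency_eq_zero_of_contactDegree_eq (contactDegree_rigidCrystal A t hy)

end Crystal

/-! ## §3 The bicrystal cell problem -/

section Cell

variable (A B : EuclideanSpace ℝ (Fin 3) ≃ₗᵢ[ℝ] EuclideanSpace ℝ (Fin 3))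
  (n : EuclideanSpace ℝ (Fin 3)) (ρ R : ℝ)

/-- The lower far-field region `{⟪y, n⟫ ≤ −R}` (occupied by the crystal `A·Λ₀`)
[cite: AlicandroBraidesCicaleseSolci2023, (7.8)–(7.9)]. -/
def farFieldBelow : Set (EuclideanSpace ℝ (Fin 3)) := {y | ⟪y, n⟫ ≤ -R}

/-- The upper far-field region `{⟪y, n⟫ ≥ R}` (occupied by a translate of the crystal `B·Λ₀`)
[cite: AlicandroBraidesCicaleseSolci2023, (7.8)–(7.9)]. -/
def farFieldAbove : Set (EuclideanSpace ℝ (Fin 3)) := {y | R ≤ ⟪y, n⟫}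

/-- **Admissible configurations of the bicrystal cell problem**: unit packings equal to the rigid
half-crystal `A·Λ₀` on `{⟪y, n⟫ ≤ −R}` and to some translate `B·Λ₀ + t` (`t` free) on
`{⟪y, n⟫ ≥ R}`; free in the slab `|⟪y, n⟫| < R`.  This is the boundary datum `u = u^{l,l',ν}` outside
the free region of the cell formula [cite: AlicandroBraidesCicaleseSolci2023, Thm. 7.10 (7.7)–(7.8)],
with the two ground states the two rigid crystals. -/
structure IsBicrystalAdmissible (A B : EuclideanSpace ℝ (Fin 3) ≃ₗᵢ[ℝ] EuclideanSpace ℝ (Fin 3))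
    (n : EuclideanSpace ℝ (Fin 3)) (R : ℝ) (X : Set (EuclideanSpace ℝ (Fin 3))) : Prop where
  /-- hard cores do not overlap. -/
  isUnitPacking : IsUnitPacking X
  /-- below the slab the configuration IS the crystal `A·Λ₀`. -/
  inter_below : X ∩ farFieldBelow n R = rigidCrystal A 0 ∩ farFieldBelow n R
  /-- above the slab the configuration IS a translate of the crystal `B·Λ₀`. -/
  exists_inter_above : ∃ t : EuclideanSpace ℝ (Fin 3),
    X ∩ farFieldAbove n R = rigidCrystal B t ∩ farFieldAbove n R

/-- The **cell**: lateral distance `≤ ρ` from the axis `ℝ n` and height `|⟪y, n⟫| ≤ R + 1` (the slab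
plus a collar of width `1`, beyond which a perfect half-crystal has no deficiency)
[cite: AlicandroBraidesCicaleseSolci2023, (7.7) (the cell `Q_T^ν`)]. -/
def interfaceCell : Set (EuclideanSpace ℝ (Fin 3)) :=
  {y | ‖y - ⟪y, n⟫ • n‖ ≤ ρ ∧ |⟪y, n⟫| ≤ R + 1}

/-- The **cell deficiency** `D_{n,ρ,R}(X) = Σ_{y ∈ X ∩ cell} (12 − deg_X y)/2` (a `finsum`; the
support is finite for packings) — the energy `E₁(u, Q_T^ν)` of the cell formula in deficiency
units [cite: AlicandroBraidesCicaleseSolci2023, (7.7)] [cite: CicaleseKreutzLeonardi2023, p. 6]. -/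
def interfaceCellDeficiency (X : Set (EuclideanSpace ℝ (Fin 3))) : ℝ :=
  ∑ᶠ y ∈ X ∩ interfaceCell n ρ R, localDeficiency X y

/-- The **cell infimum** `inf { D_{n,ρ,R}(X) : X admissible for (A, B, n, R) }` (a real `sInf`;
the value set is non-empty for `‖n‖ = 1`, `R ≥ 1/2`, `isBicrystalAdmissible_gap`, and bounded
below by `0`, `interfaceCellDeficiency_nonneg`) [cite: AlicandroBraidesCicaleseSolci2023, (7.7)]. -/
def stickyInterfaceCellInf : ℝ :=
  sInf (interfaceCellDeficiency n ρ R '' {X | IsBicrystalAdmissible A B n R X})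

/-- The interface energy density AT slab half-width `R`:
`τ_R(A, B, n) = liminf_{ρ → ∞} (π ρ²)⁻¹ · inf_X D_{n,ρ,R}(X)`
[cite: AlicandroBraidesCicaleseSolci2023, (7.7) (the inner `liminf_T T^{1-d} inf`)]. -/
def stickyInterfaceEnergyAt : ℝ :=
  Filter.liminf (fun ρ : ℝ => stickyInterfaceCellInf A B n ρ R / (Real.pi * ρ ^ 2)) Filter.atTop

/-- **The interface (grain-boundary) energy density `τ(A, B, n)` of two rigid fcc half-crystals of
sticky unit spheres** — orientation `A` below and `B` above the plane `n^⊥`, relative translation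
free: `τ = inf_{R ≥ 1} τ_R`, the slab-width relaxation `R → ∞` playing the role of `lim_{δ → 0}`
in the printed cell formula (for `‖n‖ = 1` a configuration admissible for `R` is admissible for
every `R' ≥ R` with the same cell energy, whence `τ_R` is intended to be non-increasing and the
infimum a limit; that monotonicity and the a-priori bound `τ ≤ C` are NOT proved in this file).
Only `R ≥ 1` enters, so that the admissible class is never empty (`isBicrystalAdmissible_gap`)
[cite: AlicandroBraidesCicaleseSolci2023, Thm. 7.10 (7.7)–(7.8)]. -/
def stickyInterfaceEnergy : ℝ :=
  ⨅ R : {R : ℝ // 1 ≤ R}, stickyInterfaceEnergyAt A B n R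

variable {A B n ρ R}

/-- [cite: AlicandroBraidesCicaleseSolci2023, (7.8)–(7.9)] -/
theorem mem_farFieldBelow_iff {y : EuclideanSpace ℝ (Fin 3)} : y ∈ farFieldBelow n R ↔ ⟪y, n⟫ ≤ -R :=
  Iff.rfl

/-- [cite: AlicandroBraidesCicaleseSolci2023, (7.8)–(7.9)] -/
theorem mem_farFieldAbove_iff {y : EuclideanSpace ℝ (Fin 3)} : y ∈ farFieldAbove n R ↔ R ≤ ⟪y, n⟫ :=
  Iff.rfl

/-- [cite: AlicandroBraidesCicaleseSolci2023, (7.7)] -/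
theorem mem_interfaceCell_iff {y : EuclideanSpace ℝ (Fin 3)} :
    y ∈ interfaceCell n ρ R ↔ ‖y - ⟪y, n⟫ • n‖ ≤ ρ ∧ |⟪y, n⟫| ≤ R + 1 :=
  Iff.rfl

/-- The cell deficiency of a unit packing is non-negative
[cite: CicaleseKreutzLeonardi2023, p. 6]. -/
theorem interfaceCellDeficiency_nonneg {X : Set (EuclideanSpace ℝ (Fin 3))} (hX : IsUnitPacking X) :
    0 ≤ interfaceCellDeficiency n ρ R X :=
  finsum_nonneg fun y => finsum_nonneg fun _ => localDeficiency_nonneg hX y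

/-- A configuration all of whose balls in the cell have twelve contacts has cell deficiency `0`
[cite: CicaleseKreutzLeonardi2023, p. 6]. -/
theorem interfaceCellDeficiency_eq_zero_of_forall {X : Set (EuclideanSpace ℝ (Fin 3))}
    (h : ∀ y ∈ X, localDeficiency X y = 0) : interfaceCellDeficiency n ρ R X = 0 := by
  unfold interfaceCellDeficiency
  exact finsum_mem_of_eqOn_zero fun y hy => h y hy.1

/-- The cell infimum is non-negative [cite: AlicandroBraidesCicaleseSolci2023, (7.7)]. -/
theorem stickyInterfaceCellInf_nonneg : 0 ≤ stickyInterfaceCellInf A B n ρ R := by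
  refine Real.sInf_nonneg ?_
  rintro _ ⟨X, hX, rfl⟩
  exact interfaceCellDeficiency_nonneg hX.isUnitPacking

/-- The cell infimum is at most the cell deficiency of any admissible configuration
[cite: AlicandroBraidesCicaleseSolci2023, (7.7)]. -/
theorem stickyInterfaceCellInf_le {X : Set (EuclideanSpace ℝ (Fin 3))}
    (hX : IsBicrystalAdmissible A B n R X) : stickyInterfaceCellInf A B n ρ R ≤ interfaceCellDeficiency n ρ R X :=
  csInf_le ⟨0, by rintro _ ⟨Y, hY, rfl⟩; exact interfaceCellDeficiency_nonneg hY.isUnitPacking⟩ ⟨X, hX, rfl⟩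

/-- `τ_R ≥ 0` [cite: AlicandroBraidesCicaleseSolci2023, (7.7)]. -/
theorem stickyInterfaceEnergyAt_nonneg : 0 ≤ stickyInterfaceEnergyAt A B n R := by
  unfold stickyInterfaceEnergyAt
  rw [Filter.liminf_eq]
  set S : Set ℝ := {a | ∀ᶠ ρ in Filter.atTop,
    a ≤ stickyInterfaceCellInf A B n ρ R / (Real.pi * ρ ^ 2)} with hS
  have h0 : (0 : ℝ) ∈ S := Filter.Eventually.of_forall fun ρ =>
    div_nonneg stickyInterfaceCellInf_nonneg (mul_nonneg Real.pi_pos.le (sq_nonneg ρ))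
  by_cases hb : BddAbove S
  · exact le_csSup hb h0
  · rw [Real.sSup_of_not_bddAbove hb]

/-- **`τ(A, B, n) ≥ 0`** [cite: AlicandroBraidesCicaleseSolci2023, Thm. 7.10 (`φ ≥ 0`)]. -/
theorem stickyInterfaceEnergy_nonneg : 0 ≤ stickyInterfaceEnergy A B n :=
  Real.iInf_nonneg fun _ => stickyInterfaceEnergyAt_nonneg

/-! ### No boundary, no cost: `τ(A, A, n) = 0` -/

/-- The perfect crystal `A·Λ₀` is admissible for the cell problem `(A, A, n, R)` (with `t = 0`)
[cite: AlicandroBraidesCicaleseSolci2023, (7.7)–(7.8) (`l = l'`)]. -/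
theorem isBicrystalAdmissible_rigidCrystal (A : EuclideanSpace ℝ (Fin 3) ≃ₗᵢ[ℝ] EuclideanSpace ℝ (Fin 3))
    (n : EuclideanSpace ℝ (Fin 3)) (R : ℝ) : IsBicrystalAdmissible A A n R (rigidCrystal A 0) where
  isUnitPacking := isUnitPacking_rigidCrystal A 0
  inter_below := rfl
  exists_inter_above := ⟨0, rfl⟩

/-- The perfect crystal has cell deficiency `0` [cite: CicaleseKreutzLeonardi2023, p. 6]. -/
theorem interfaceCellDeficiency_rigidCrystal (A : EuclideanSpace ℝ (Fin 3) ≃ₗᵢ[ℝ] EuclideanSpace ℝ (Fin 3))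
    (t : EuclideanSpace ℝ (Fin 3)) : interfaceCellDeficiency n ρ R (rigidCrystal A t) = 0 :=
  interfaceCellDeficiency_eq_zero_of_forall fun _ hy => localDeficiency_rigidCrystal A t hy

/-- For `B = A` the cell infimum vanishes [cite: AlicandroBraidesCicaleseSolci2023, (7.7) (`l = l'`)]. -/
theorem stickyInterfaceCellInf_self (A : EuclideanSpace ℝ (Fin 3) ≃ₗᵢ[ℝ] EuclideanSpace ℝ (Fin 3))
    (n : EuclideanSpace ℝ (Fin 3)) (ρ R : ℝ) : stickyInterfaceCellInf A A n ρ R = 0 :=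
  le_antisymm ((stickyInterfaceCellInf_le (isBicrystalAdmissible_rigidCrystal A n R)).trans
    (interfaceCellDeficiency_rigidCrystal A 0).le) stickyInterfaceCellInf_nonneg

/-- [cite: AlicandroBraidesCicaleseSolci2023, (7.7) (`l = l'`)] -/
theorem stickyInterfaceEnergyAt_self (A : EuclideanSpace ℝ (Fin 3) ≃ₗᵢ[ℝ] EuclideanSpace ℝ (Fin 3))
    (n : EuclideanSpace ℝ (Fin 3)) (R : ℝ) : stickyInterfaceEnergyAt A A n R = 0 := by
  unfold stickyInterfaceEnergyAt
  simp only [stickyInterfaceCellInf_self, zero_div]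
  exact Filter.liminf_const 0

/-- **`τ(A, A, n) = 0`**: a crystal continued by itself across any plane costs nothing
[cite: AlicandroBraidesCicaleseSolci2023, Thm. 7.10 (`φ(l, l, ν) = 0`)]. -/
theorem stickyInterfaceEnergy_self (A : EuclideanSpace ℝ (Fin 3) ≃ₗᵢ[ℝ] EuclideanSpace ℝ (Fin 3))
    (n : EuclideanSpace ℝ (Fin 3)) : stickyInterfaceEnergy A A n = 0 := by
  unfold stickyInterfaceEnergy
  simp only [stickyInterfaceEnergyAt_self]
  haveI : Nonempty {R : ℝ // 1 ≤ R} := ⟨⟨1, le_rfl⟩⟩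
  exact ciInf_const

/-! ### The cell problem is not empty -/

/-- **The gap configuration** — the two half-crystals and nothing in between — is admissible as
soon as the slab is at least one diameter thick (`R ≥ 1/2`, `‖n‖ = 1`): two centres on opposite
sides of the slab are at distance `≥ 2R ≥ 1` [cite: AlicandroBraidesCicaleseSolci2023, (7.8)]. -/
theorem isBicrystalAdmissible_gap (hn : ‖n‖ = 1) (hR : 1 / 2 ≤ R) (t : EuclideanSpace ℝ (Fin 3)) :
    IsBicrystalAdmissible A B n R
      (rigidCrystal A 0 ∩ farFieldBelow n R ∪ rigidCrystal B t ∩ farFieldAbove n R) := by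
  have hRpos : 0 < R := by linarith
  -- points on opposite sides of the slab are far apart
  have hfar : ∀ {x y : EuclideanSpace ℝ (Fin 3)}, x ∈ farFieldBelow n R → y ∈ farFieldAbove n R →
      1 ≤ dist x y := by
    intro x y hx hy
    rw [mem_farFieldBelow_iff] at hx
    rw [mem_farFieldAbove_iff] at hy
    have h1 : ⟪y - x, n⟫ ≤ ‖y - x‖ * ‖n‖ := real_inner_le_norm _ _
    rw [hn, mul_one, inner_sub_left] at h1
    rw [dist_comm, dist_eq_norm]
    linarith
  have hdisj : ∀ {y : EuclideanSpace ℝ (Fin 3)}, y ∈ farFieldBelow n R → y ∉ farFieldAbove n R := by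
    intro y hy hy'
    rw [mem_farFieldBelow_iff] at hy
    rw [mem_farFieldAbove_iff] at hy'
    linarith
  refine ⟨?_, ?_, ⟨t, ?_⟩⟩
  · rintro x (⟨hxA, hxl⟩ | ⟨hxB, hxu⟩) y (⟨hyA, hyl⟩ | ⟨hyB, hyu⟩) hxy
    · exact isUnitPacking_rigidCrystal A 0 hxA hyA hxy
    · exact hfar hxl hyu
    · rw [dist_comm]; exact hfar hyl hxu
    · exact isUnitPacking_rigidCrystal B t hxB hyB hxy
  · ext y
    constructor
    · rintro ⟨(⟨hyA, _⟩ | ⟨_, hyu⟩), hyl⟩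
      · exact ⟨hyA, hyl⟩
      · exact absurd hyu (hdisj hyl)
    · rintro ⟨hyA, hyl⟩
      exact ⟨Or.inl ⟨hyA, hyl⟩, hyl⟩
  · ext y
    constructor
    · rintro ⟨(⟨_, hyl⟩ | ⟨hyB, _⟩), hyu⟩
      · exact absurd hyu (hdisj hyl)
      · exact ⟨hyB, hyu⟩
    · rintro ⟨hyB, hyu⟩
      exact ⟨Or.inr ⟨hyB, hyu⟩, hyu⟩

/-- Hence for `‖n‖ = 1` and `R ≥ 1/2` the admissible class is non-empty
[cite: AlicandroBraidesCicaleseSolci2023, (7.7)]. -/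
theorem nonempty_isBicrystalAdmissible (hn : ‖n‖ = 1) (hR : 1 / 2 ≤ R) :
    {X | IsBicrystalAdmissible A B n R X}.Nonempty :=
  ⟨_, isBicrystalAdmissible_gap hn hR 0⟩

/-- … and the cell infimum is attained-or-approached on a non-empty, bounded-below set of values
[cite: AlicandroBraidesCicaleseSolci2023, (7.7)]. -/
theorem bddBelow_image_interfaceCellDeficiency :
    BddBelow (interfaceCellDeficiency n ρ R '' {X | IsBicrystalAdmissible A B n R X}) :=
  ⟨0, by rintro _ ⟨Y, hY, rfl⟩; exact interfaceCellDeficiency_nonneg hY.isUnitPacking⟩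

end Cell

end Literature.MathematicalPhysics.StatisticalMechanics
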